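import Summits.CriticalPhenomena.Ising3D.Control2DPolyCertAuto
import Summits.CriticalPhenomena.Ising3D.Control2DL19BoxWTable
import Summits.CriticalPhenomena.Ising3D.Control2DCellGroups
import Summits.CriticalPhenomena.Ising3D.Control2DL19BoxWData117
import Summits.CriticalPhenomena.Ising3D.Control2DL19BoxWData34
import Summits.CriticalPhenomena.Ising3D.Control2DL19BoxWData35
import Summits.CriticalPhenomena.Ising3D.Control2DL19BoxWData36
import Summits.CriticalPhenomena.Ising3D.Control2DL19BoxWData37
import Summits.CriticalPhenomena.Ising3D.Control2DL19BoxWData38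
import Summits.CriticalPhenomena.Ising3D.Control2DL19BoxWData39
import Summits.CriticalPhenomena.Ising3D.Control2DL19BoxWData40
import Summits.CriticalPhenomena.Ising3D.Control2DL19BoxWData41
import Summits.CriticalPhenomena.Ising3D.Control2DL19BoxWData42
import Summits.CriticalPhenomena.Ising3D.Control2DL19BoxWData43
import HarnessLib

/-!
# Kernel replay of the RB-2 certificate `j136729_functional_deriv2d_L19_E048_sig1o8_box0.98-0.985.json` (Λ = 19, E₀ = 48): Δ_ε ∉ [49/50, 197/200] at Δ_σ = 1/8 under A2D′: cell data, SPIN file (leaf file 3 of spin 6; the literal `phatboxWs6` lives in `Control2DL19BoxWData117`): assembly + Bernstein leaves of spins 6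
(cell `pub-ising3x`, seat controls-1 gen 19; KERNEL PATH for the 2D γ-certificates, Λ = 19 — CONTROL-ONLY)

HONEST FRAMING: lottery ticket; floor = tightest certified 3D Ising CFT bounds; no exact-solution
claim without a proof. CONTROL-ONLY (`d = 2`, `Δ_σ = 1/8`; axiom set A2D′).

FLAT layout (controls-1 g18, `Control2DCellGroups`): each spin's cell polynomial `cellPolyZ wtboxW slL19 19 ℓ Nd` is the
coefficientwise sum of INDEPENDENT index-group sums `cellPolyAcc wtboxW G 19 ℓ Nd []`, each assembled in the kernel from the
table-independent one-sided literals `uZ Nd c k` (library files `Control2DUZ*`) into a literal `grp…` (`simp only` +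
`decide +kernel`) in a GROUP file (no imports between data files of one spin); the SPIN file adds the group literals in the
kernel (`cellPolyZ_of_groups`, one `decide`) into the literal `phat…` and decides every Bernstein leaf `bernAuto phat q a L = true`
(coefficients computed in the kernel, `Control2DPolyCertAuto`). Data + kernel decisions only; the cell theorems proper are
assembled in `Control2DL19BoxWCells`. All integers come from the seat's exact mirror (HOME/code/controls/kp5: kmirror.py / gen_flat.py,
cross-checked against the independent rational twin twin.py) and are only CHECKED here. No facts, standard axioms only.
-/

namespace Summit.CriticalPhenomena.Ising3D.Control2D

open Literature.MathematicalPhysics.QuantumFieldTheory.ConformalBootstrap3D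

set_option maxHeartbeats 0 in
set_option maxRecDepth 200000 in
/-- **Kernel check of spin 6, leaf 10** (`y ∈ [21/4, 42/4]`, range C; Bernstein coefficients of the coefficients truncated by `10^517`, computed in the kernel). [folklore] -/
theorem cellChk_boxW_s6l10 : bernAuto (ptrunc phatboxWs6 517) 4 21 21 = true := by
  decide +kernel

set_option maxHeartbeats 0 in
set_option maxRecDepth 200000 in
/-- **Kernel check of spin 6, leaf 11** (`y ∈ [21/2, 42/2]`, range C; Bernstein coefficients of the coefficients truncated by `10^517`, computed in the kernel). [folklore] -/
theorem cellChk_boxW_s6l11 : bernAuto (ptrunc phatboxWs6 517) 2 21 21 = true := by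
  decide +kernel

end Summit.CriticalPhenomena.Ising3D.Control2D
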